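import Summits.NavierStokesRegularity.NavierStokesRegularity.Theorems.AveragedTypeIBlowup.Negative.NSReduction

/-!
# Route `PerpetualPump`, glue item `ThesisIffNoAveragedTypeIBlowup` (stmt-NavierStokesRegularity-14766)

The route's `closes` hypothesis `Thesis` (abstract Type-I exclusion over Tao's averaging class) is
EXACTLY the non-existence of the PDE perpetual pump: `Thesis ↔ ¬ AveragedTypeIBlowup`
(route decl `Summit.NavierStokesRegularity.NavierStokesRegularity.Theses.PerpetualPump.ThesisIffNoAveragedTypeIBlowup`).

Pure classical logic from the landed negative-side lemma
`Theorems.AveragedTypeIBlowup.Negative.averagedTypeIBlowup_iff_not_thesis : AveragedTypeIBlowup ↔ ¬ Thesis`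
(file `Theorems/AveragedTypeIBlowup/Negative/NSReduction.lean`) and Mathlib's `iff_not_comm`.

Polarity (planner's point): this identifies `Thesis` with `¬` crux #3, so deciding
`AveragedTypeIBlowup` either way is a ledger event for `Thesis` (refuted ⇒ `Thesis`; proved ⇒
`¬ Thesis`, route broken by design). It asserts no implication from a proof of the pump to the thesis.
-/

-- the nested summit namespace `…NavierStokesRegularity.NavierStokesRegularity…` is the tree's layout (D-0017)
set_option linter.dupNamespace false

namespace Summit.NavierStokesRegularity.NavierStokesRegularity.Theorems

open Summit.NavierStokesRegularity.NavierStokesRegularity.Theses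

/-- **Glue item `ThesisIffNoAveragedTypeIBlowup`** (stmt-NavierStokesRegularity-14766, route
`PerpetualPump`): the route target `Thesis` holds iff there is no averaged Type-I blow-up,
`Thesis ↔ ¬ AveragedTypeIBlowup`. Classical contraposition (`iff_not_comm`) of
`AveragedTypeIBlowup.Negative.averagedTypeIBlowup_iff_not_thesis : AveragedTypeIBlowup ↔ ¬ Thesis`.
[folklore] -/
theorem perpetualPump_thesisIffNoAveragedTypeIBlowup_proof :
    PerpetualPump.ThesisIffNoAveragedTypeIBlowup := by
  unfold PerpetualPump.ThesisIffNoAveragedTypeIBlowup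
  exact iff_not_comm.mp
    _root_.Summit.NavierStokesRegularity.NavierStokesRegularity.Theorems.AveragedTypeIBlowup.Negative.averagedTypeIBlowup_iff_not_thesis

end Summit.NavierStokesRegularity.NavierStokesRegularity.Theorems
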